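import Summits.ResolutionOfSingularities.ResolutionOfSingularities.Theorems.WildDescent12
import Summits.ResolutionOfSingularities.ResolutionOfSingularities.Theorems.WallFrames17
import HarnessLib

/-!
# WildDescent (13/13) — β-descent in a linear frame; §9 Walk level: `noBalancedStrictSkewTailsDeep_pfree`, `noWildBalancedStrictTailsDeep_holds : WallCut.NoWildBalancedStrictTailsDeep`, tame control; §10 Column bookkeeping

Verbatim slice of the farm-checked monolith `WildDescent.lean` of cell `decomp-res`, seat `decomp-res-lens-5`, g36
(sha256 4ec0fa6f4f9efba7…); one namespace `Summit.ResolutionOfSingularities.ResolutionOfSingularities.Theorems.WildDescent` across the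
slices, imports chained (laws L1–L7 and the mechanism: module docstring of slice 1; main theorems: slice 13/13).
-/

open MvPolynomial Finset
open scoped BigOperators
open Literature.AlgebraicGeometry.Resolution
open Literature.AlgebraicGeometry.Resolution.Hauser2010
open Literature.AlgebraicGeometry.Resolution.PointBlowup
open Literature.AlgebraicGeometry.Resolution.HauserPerlega2024

namespace Summit.ResolutionOfSingularities.ResolutionOfSingularities.Theorems.WildDescent

/-! ## §9  The walk level: the wild (and tame) δ-balanced strict cell, hypothesis-free

Along a δ-balanced strict plateau of shade `s` of a forced walk we feed the COMPANION CHAIN (`NearCut.companion`, shifted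
past the shedding stage `m₀` of `NearCut.sheddingLemma`) to the abstract wall-chain theorem `wallChain_false`:
near (`NearCut.companionLaw`), pure tangent cone (`NearCut.directrix_of_plateau`), isolated (`NearCut.sheddingLemma`),
walls kept/lost (`NearCut.walls_succ`), transversal (the STRICT binder: an initial monomial with positive exponent in the
free letter forces `∂ℓ/∂y_free ≠ 0`), skew (the every-letter-i.o. binder).  The divisibility `p ∣ s` is never used. -/

section Walk

open Summit.ResolutionOfSingularities.ResolutionOfSingularities.Theses
open Summit.ResolutionOfSingularities.ResolutionOfSingularities.Theorems.TightDefectClasses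
open Summit.ResolutionOfSingularities.ResolutionOfSingularities.Theorems.ItineraryCutClasses
open Summit.ResolutionOfSingularities.ResolutionOfSingularities.Theorems.BoundaryLedger
open Summit.ResolutionOfSingularities.ResolutionOfSingularities.Theorems.ProximityCut
open Summit.ResolutionOfSingularities.ResolutionOfSingularities.Theorems

variable {K : Type} [Field K]

/-- **TRANSVERSALITY FROM STRICTNESS (kernel).**  If `y^r · (C c · ℓ^s)` (times a unit constant) is the initial form and
some initial monomial `d` has `d x > r x`, then `∂ℓ/∂y_x ≠ 0`. [new] -/
theorem coeff_single_ne_zero_of_strict {f k l : Fin 3} (hfk : f ≠ k) (hfl : f ≠ l) (hkl : k ≠ l)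
    {ℓ : MvPolynomial (Fin 3) K} (hℓ : ℓ.IsHomogeneous 1) {s : ℕ} {r d : Fin 3 →₀ ℕ} {a : K}
    (hd : coeff d (monomial r a * ℓ ^ s) ≠ 0) (hdx : r f < d f) : coeff (Finsupp.single f 1) ℓ ≠ 0 := by
  classical
  intro h0
  rw [coeff_monomial_mul'] at hd
  split_ifs at hd with hrd
  · have hmem : d - r ∈ (ℓ ^ s).support := by
      rw [mem_support_iff]; exact right_ne_zero_of_mul hd
    have hlin := linear_eq_three hfk hfl hkl hℓ
    rw [h0, C_0, zero_mul, zero_add] at hlin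
    have hfree : ∀ μ ∈ (ℓ ^ s).support, μ f = 0 := by
      rw [hlin]; exact varFree_pow (varFree_lin hfk.symm hfl.symm _ _) s
    have := hfree _ hmem
    rw [Finsupp.tsub_apply] at this
    omega
  · exact hd rfl

/-- **THE δ-BALANCED STRICT SKEW CELL IS EMPTY — uniformly in `p` (no divisibility hypothesis on `s`).**  This is the
super-statement of both `WallCut.NoWildBalancedStrictTailsDeep` (`p ∣ s`) and `WallCut.NoTameBalancedStrictTailsDeep`
(`p ∤ s`): the binder `p ∣ s` / `¬ p ∣ s` is simply absent.  Proof: companion chain ⟶ `wallChain_false`.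
[cite: CossartJannsenSaito2020, §§10–12; Kollar2007, 2.59; new: the wild case] -/
theorem noBalancedStrictSkewTailsDeep_pfree :
    ∀ p : ℕ, p.Prime → ∀ e : ℕ, 2 ≤ e → ∀ (K : Type) [Field K] [CharP K p] [PerfectField K] [DecidableEq K]
      (s₀ : State (Fin 3) K), IsRoot (p ^ e) s₀ → ∀ W : ForcedWalk (p ^ e) s₀, (∀ i, 1 ≤ (W.st i).shade) →
      ∀ N : ℕ, (∀ t, N ≤ t → (W.st (t + 1)).shade = (W.st t).shade) →
      (∀ t, N ≤ t → ordZero (W.st t).F ≠ ((p ^ e : ℕ) : ℕ∞)) → (∀ M : ℕ, ∃ t, M ≤ t ∧ StaysOnNewest W t) →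
      (∀ M : ℕ, ∃ t, M ≤ t ∧ W.b t ≠ 0) →
      ∀ s : ℕ, (W.st N).shade = (s : ℕ∞) → 3 ≤ s → p ^ e + 3 ≤ 3 * s → p ^ e + 2 ≤ 2 * s →
      (∀ (k : Fin 3) (N' : ℕ), ∃ t, N' ≤ t ∧ (W.j t = k ∨ W.b t k ≠ 0)) →
      (∀ t, N ≤ t → ((∀ y, (W.st t).r y + 1 ≤ s) ∧ ∃ x, (W.st t).r x = 0 ∧
        ∃ d ∈ (W.st t).F.support, ((d.degree : ℕ) : ℕ∞) = ordZero (W.st t).F ∧ (W.st t).r x < d x)) →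
      (∀ t, N ≤ t → ((W.st t).r.degree + 2 * s = 2 * p ^ e ∧
        ∃ x, (W.st t).r x = 0 ∧ ∀ y, y ≠ x → (W.st t).r y + s = p ^ e)) → False := by
  intro p hp e he K _ _ _ _ s₀ hroot W _ N hplat hbig hrec _ s hs h3 _ _ hskew hstrict hbal
  classical
  have h2 : 2 ≤ s := by omega
  have hshade := NearCut.shade_of_plateau W N s hplat hs
  have hbig' : ∀ t, N ≤ t → ((p ^ e : ℕ) : ℕ∞) < ordZero (W.st t).F :=
    fun t ht => lt_of_le_of_ne (walk_ord hroot W t) (fun h => hbig t ht h.symm)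
  have hsq : s < p ^ e := NearCut.lt_of_balanced hroot W N s hs (hbig N le_rfl) (hbal N le_rfl).1
  -- the dictionary pieces (all landed theorems)
  have hCW := NearCut.companionLaw p hp e he K s₀ hroot W N hplat hbig s hs h2 hbal
  obtain ⟨m₀, hm₀⟩ := NearCut.sheddingLemma p hp e he K s₀ hroot W N hplat hbig hrec s hs h2 hbal
  -- pure tangent cones, with the boundary unit cancelled, and TRANSVERSAL to the free letter
  have hdir : ∀ n, ∃ (c : K) (ℓ : MvPolynomial (Fin 3) K), c ≠ 0 ∧ ℓ.IsHomogeneous 1 ∧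
      homogeneousComponent s (NearCut.companion W N s n) = C c * ℓ ^ s ∧
      ∀ (f k l : Fin 3), f ≠ k → f ≠ l → k ≠ l → (W.st (N + n)).r f = 0 → (W.st (N + n)).r k ≠ 0 →
        (W.st (N + n)).r l ≠ 0 → coeff (Finsupp.single f 1) ℓ ≠ 0 := by
    intro n
    obtain ⟨hord, c₁, hc₁, hlay⟩ := hCW n
    obtain ⟨o, ho, -⟩ := walk_nat hroot W (N + n)
    obtain ⟨s', hs', hos⟩ := order_eq_shade_add_degree hroot W (N + n) ho
    have hss : s' = s := by have h := hs'.symm.trans (hshade (N + n) (by omega)); exact_mod_cast h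
    obtain ⟨c₂, ℓ, hc₂, hℓ1, -, hid⟩ :=
      NearCut.directrix_of_plateau hroot W N hplat hbig' hrec hs (N + n) (by omega) o ho
    have ho' : o = (W.st (N + n)).r.degree + s := by omega
    rw [ho', hlay] at hid
    have hyr : (monomial (W.st (N + n)).r (1 : K)) ≠ 0 := fun h => one_ne_zero (monomial_eq_zero.mp h)
    have h1 : monomial (W.st (N + n)).r (1 : K) * homogeneousComponent s (NearCut.companion W N s n)
        = monomial (W.st (N + n)).r (1 : K) * (C (c₁⁻¹ * c₂) * ℓ ^ s) := by
      have h : C c₁⁻¹ * (C c₁ * (monomial (W.st (N + n)).r (1 : K) *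
          homogeneousComponent s (NearCut.companion W N s n)))
          = C c₁⁻¹ * (C c₂ * (monomial (W.st (N + n)).r 1 * ℓ ^ s)) := by rw [hid]
      rw [← mul_assoc, ← map_mul, inv_mul_cancel₀ hc₁, map_one, one_mul] at h
      rw [h, map_mul]; ring
    have hin := mul_left_cancel₀ hyr h1
    refine ⟨c₁⁻¹ * c₂, ℓ, mul_ne_zero (inv_ne_zero hc₁) hc₂, hℓ1, hin, ?_⟩
    intro f k l hfk hfl hkl hrf hrk hrl
    obtain ⟨-, x, hx0, d, hd, hdeg, hxd⟩ := hstrict (N + n) (by omega)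
    have hxf : x = f := by
      rcases fin3_exhaust hfk hfl hkl x with h | h | h
      · exact h
      · exact absurd hx0 (h ▸ hrk)
      · exact absurd hx0 (h ▸ hrl)
    subst hxf
    have hdeg' : d.degree = o := by rw [ho] at hdeg; exact_mod_cast hdeg
    have hcoeff : coeff d (homogeneousComponent o (W.st (N + n)).F) ≠ 0 := by
      rw [coeff_homogeneousComponent, if_pos hdeg']; exact mem_support_iff.mp hd
    have hform : C c₁ * (monomial (W.st (N + n)).r (1 : K) * (C (c₁⁻¹ * c₂) * ℓ ^ s))
        = monomial (W.st (N + n)).r c₂ * ℓ ^ s := by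
      rw [map_mul, show monomial (W.st (N + n)).r c₂ = C c₂ * monomial (W.st (N + n)).r (1 : K) by
        rw [C_mul_monomial, mul_one]]
      have hcc : C c₁ * C c₁⁻¹ = (1 : MvPolynomial (Fin 3) K) := by rw [← map_mul, mul_inv_cancel₀ hc₁, map_one]
      calc _ = (C c₁ * C c₁⁻¹) * (C c₂ * monomial (W.st (N + n)).r 1) * ℓ ^ s := by ring
        _ = _ := by rw [hcc, one_mul]
    rw [ho', hlay, hin, hform] at hcoeff
    exact coeff_single_ne_zero_of_strict hfk hfl hkl hℓ1 hcoeff hxd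
  choose cc ll hcc hll hin' htr' using hdir
  -- WALLS: the kept wall `kw n` of move `N+n` (old wall, zero translation, still a wall), the free letter `fr n`
  have hsucc : ∀ n, (W.st (N + n + 1)).r (W.j (N + n)) = p ^ e - s ∧
      ∃ k, k ≠ W.j (N + n) ∧ (W.st (N + n)).r k = p ^ e - s ∧ W.b (N + n) k = 0 ∧
        (W.st (N + n + 1)).r k = p ^ e - s ∧ ∀ i, i ≠ W.j (N + n) → i ≠ k → (W.st (N + n + 1)).r i = 0 :=
    fun n => NearCut.walls_succ hroot W (N + n) s (hshade _ (by omega)) (hbig _ (by omega)) (hbal _ (by omega)).1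
      (hbal _ (by omega))
  choose kw hkwj hkwr hkwb hkwr' hkw0 using fun n => (hsucc n).2
  have hexc : ∀ n, (W.st (N + n + 1)).r (W.j (N + n)) = p ^ e - s := fun n => (hsucc n).1
  choose fr hfr0 hfr using fun n => (hbal (N + n) (by omega)).2
  have hthird : ∀ a b : Fin 3, ∃ k : Fin 3, k ≠ a ∧ k ≠ b := by decide
  choose th hth1 hth2 using hthird
  have hδ : p ^ e - s ≠ 0 := by omega
  -- letters of the shifted chain: `k n = kw (m₀+n)`, `f n = fr (m₀+n)`, `l n = th (k n) (f n)`
  have hfk : ∀ n, fr (m₀ + n) ≠ kw (m₀ + n) := by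
    intro n h; have := hkwr (m₀ + n); rw [← h, hfr0] at this; exact hδ this.symm
  have hrl : ∀ n, (W.st (N + (m₀ + n))).r (th (kw (m₀ + n)) (fr (m₀ + n))) = p ^ e - s := by
    intro n; have := hfr (m₀ + n) _ (hth2 (kw (m₀ + n)) (fr (m₀ + n))); omega
  -- the next free letter is the third letter of move `N+m₀+n` (neither the chart slot nor the kept wall)
  have hidx : ∀ n, N + (m₀ + n) + 1 = N + (m₀ + (n + 1)) := fun n => by omega
  have hfr_j : ∀ n, fr (m₀ + (n + 1)) ≠ W.j (N + (m₀ + n)) := by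
    intro n h; have := hexc (m₀ + n); rw [hidx, ← h, hfr0] at this; exact hδ this.symm
  have hfr_k : ∀ n, fr (m₀ + (n + 1)) ≠ kw (m₀ + n) := by
    intro n h; have := hkwr' (m₀ + n); rw [hidx, ← h, hfr0] at this; exact hδ this.symm
  have hthird' : ∀ n i, i ≠ fr (m₀ + (n + 1)) → i = W.j (N + (m₀ + n)) ∨ i = kw (m₀ + n) := by
    intro n i hi
    by_contra h
    simp only [not_or] at h
    exact hi (NearCut.fin3_fourth (fr (m₀ + (n + 1))) (W.j (N + (m₀ + n))) (kw (m₀ + n)) i (hfr_j n) (hfr_k n)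
      (hkwj (m₀ + n)).symm h.1 h.2)
  -- feed the abstract wall-chain theorem
  refine wallChain_false (s := s) (G := fun n => NearCut.companion W N s (m₀ + n))
    (j := fun n => W.j (N + (m₀ + n))) (b := fun n => W.b (N + (m₀ + n)))
    (k := fun n => kw (m₀ + n)) (l := fun n => th (kw (m₀ + n)) (fr (m₀ + n))) (f := fun n => fr (m₀ + n))
    (c := fun n => cc (m₀ + n)) (ℓ := fun n => ll (m₀ + n))
    (by omega) (fun n => (hth1 _ _).symm) hfk (fun n => (hth2 _ _).symm)
    (fun n => NearCut.companion_succ W N s (m₀ + n)) (fun n => (hCW (m₀ + n)).1) (fun n => hcc (m₀ + n))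
    (fun n => hll (m₀ + n)) (fun n => hin' (m₀ + n))
    (fun n => htr' (m₀ + n) _ _ _ (hfk n) (fun h => hth2 _ _ h.symm) (fun h => hth1 _ _ h.symm) (hfr0 (m₀ + n))
      (by rw [hkwr]; exact hδ) (by rw [hrl]; exact hδ))
    (fun n => hm₀ (m₀ + n) (by omega)) (fun n => ?_) (fun n i hi => ?_) (fun n => ?_) (fun i M => ?_)
  · -- the chart slot is never the kept wall
    rcases fin3_exhaust (hfk n) (fun h => hth2 _ _ h.symm) (fun h => hth1 _ _ h.symm) (W.j (N + (m₀ + n))) with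
      h | h | h
    · exact Or.inr h
    · exact absurd h.symm (hkwj (m₀ + n))
    · exact Or.inl h
  · -- the centre lies on the new free axis
    rcases hthird' n i hi with h | h
    · rw [h]; exact W.onExc _
    · rw [h]; exact hkwb (m₀ + n)
  · -- walls of the next stage are `{j, kept}`; the next kept wall is one of them and the next lost wall the other
    have hk' : kw (m₀ + (n + 1)) = W.j (N + (m₀ + n)) ∨ kw (m₀ + (n + 1)) = kw (m₀ + n) :=
      hthird' n _ (hfk (n + 1)).symm
    have hl' : th (kw (m₀ + (n + 1))) (fr (m₀ + (n + 1))) = W.j (N + (m₀ + n)) ∨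
        th (kw (m₀ + (n + 1))) (fr (m₀ + (n + 1))) = kw (m₀ + n) := hthird' n _ (hth2 _ _)
    have hne := hth1 (kw (m₀ + (n + 1))) (fr (m₀ + (n + 1)))
    rcases hk' with hk' | hk'
    · refine Or.inr ⟨hk', ?_⟩
      rcases hl' with hl' | hl'
      · exact absurd (hl'.trans hk'.symm) hne
      · exact hl'
    · refine Or.inl ⟨hk', ?_⟩
      rcases hl' with hl' | hl'
      · exact hl'
      · exact absurd (hl'.trans hk'.symm) hne
  · -- skewness survives the shift
    obtain ⟨t, ht, h⟩ := hskew i (N + (m₀ + M))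
    refine ⟨t - (N + m₀), by omega, ?_⟩
    have : N + (m₀ + (t - (N + m₀))) = t := by omega
    simp only [this]
    exact h

/-- **THE WILD δ-BALANCED STRICT CELL IS EMPTY** — `WallCut.NoWildBalancedStrictTailsDeep`, HYPOTHESIS-FREE.
(The tame/wild split `p ∤ s` / `p ∣ s` of the column turns out to be immaterial for the β-descent in a linear frame.)
[cite: CossartJannsenSaito2020, §§10–12; new: wild case `p ∣ s`] -/
theorem noWildBalancedStrictTailsDeep_holds : WallCut.NoWildBalancedStrictTailsDeep := by
  intro p hp e he K _ _ _ _ s₀ hroot W h1 N hplat hbig hrec htrl s hs h3 h3s h2s hskew hstrict _ hbal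
  exact noBalancedStrictSkewTailsDeep_pfree p hp e he K s₀ hroot W h1 N hplat hbig hrec htrl s hs h3 h3s h2s hskew
    hstrict hbal

-- writer g14: CONTROL theorem `noTameBalancedStrictTailsDeep_of_pfree` deleted — dedup.landed twin of
-- `WallFrames.noTameBalancedStrictTailsDeep_holds` [Theorems/WallFrames17] (bounce p829012); the use site below cites the landed name.

end Walk

/-! ## §10  Column bookkeeping (critic 226a (vi)): with the free-point class (`ProximityCut.noFreePointTailsDeep_holds`),
the high planar joint class (`GhostDescent.noHighPlanarJointTailsDeep_holds`) and now BOTH δ-balanced strict classes closed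
hypothesis-free, the host aside `MaxContactCut.DefectWalksDeep` (31770) is EXACTLY the δ-balanced boundary class ∧ the
LOSSY strict class; modulo g35's `BalancedWallPort` (whose proof `WallFrames.balancedWallPort_holds` is landing) it is
exactly lens-3's LOSSY cell. -/

section Column

open Summit.ResolutionOfSingularities.ResolutionOfSingularities.Theses
open Summit.ResolutionOfSingularities.ResolutionOfSingularities.Theorems

/-- **31770 RE-LOCATED (hypothesis-free, by name):** `DefectWalksDeep ⟺ NoBalancedBoundaryTailsDeep ∧ NoLossyStrictTailsDeep`.
[new; composition] -/
theorem defectWalksDeep_iff_boundary_lossy :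
    MaxContactCut.DefectWalksDeep ↔ FreezeCut.NoBalancedBoundaryTailsDeep ∧ WallCut.NoLossyStrictTailsDeep :=
  WallCut.defectWalksDeep_iff_highPlanar_boundary_lossy_tame_wild.trans
    ⟨fun h => ⟨h.2.2.1, h.2.2.2.1⟩, fun h =>
      ⟨ProximityCut.noFreePointTailsDeep_holds, GhostDescent.noHighPlanarJointTailsDeep_holds, h.1, h.2,
        WallFrames.noTameBalancedStrictTailsDeep_holds, noWildBalancedStrictTailsDeep_holds⟩⟩  -- writer g14: landed twin cited

/-- **31770 RE-LOCATED modulo the balanced wall port:** `DefectWalksDeep ⟺ NoLossyStrictTailsDeep` — the column residual is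
exactly the LOSSY strict cell. [new; composition] -/
theorem defectWalksDeep_iff_lossy_of_port (hπ : WallCut.BalancedWallPort) :
    MaxContactCut.DefectWalksDeep ↔ WallCut.NoLossyStrictTailsDeep :=
  defectWalksDeep_iff_boundary_lossy.trans
    ⟨fun h => h.2, fun h => ⟨WallCut.noBalancedBoundaryTails_of_balancedWallPort hπ, h⟩⟩

/-- The LOSSY strict cell alone now closes the host aside. [new; composition] -/
theorem defectWalksDeep_of_lossy (hπ : WallCut.BalancedWallPort) (h : WallCut.NoLossyStrictTailsDeep) :
    MaxContactCut.DefectWalksDeep :=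
  (defectWalksDeep_iff_lossy_of_port hπ).mpr h

end Column

end Summit.ResolutionOfSingularities.ResolutionOfSingularities.Theorems.WildDescent
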